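import Mathlib
import Literature.Barriers.ValiantsHypothesis.AlgebraicNaturalProofs
import HarnessLib

/-!
# Crux `BarrierLever.SuccinctHittingSetsForVP` (stmt-ValiantsHypothesis-14610), line `registered` —
RISING-FACTORIAL FINITE DIFFERENCES ARE DIAGONAL ON A DEGREE SLICE (registered stub
`stub_risingDiagonal`)

**What is proved (it does NOT close the item).** The registered stub `stub_risingDiagonal` of the
skeleton `Cruxes/SuccinctHittingSetsForVP/Lines/birth.lean`: for exponent vectors
`u v : Fin n →₀ ℕ` of the same degree,
`∑_{w ≤ v} (-1)^{|v - w|} (∏ᵢ C(vᵢ, wᵢ)) ∏ᵢ (wᵢ + uᵢ)!/wᵢ! = [u = v] ∏ᵢ uᵢ!`,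
i.e. the `v`-th iterated forward difference at `0` of the coefficient function
`w ↦ ∏ᵢ (wᵢ + uᵢ)!/wᵢ!` (a polynomial of multidegree `u` in `w`) is the diagonal matrix
`diag(∏ᵢ uᵢ!)` on the slice `|u| = |v|`.

**Why.** Wave 5 of the crux shows that Nisan–Wigderson's partial-derivative measure is maximal on
small circuits: the all-ones polynomial `f = Σ_{|m| ≤ n} x^m` has linearly independent order-`k`
partial derivatives `∂^u f`, `|u| = k ≤ n/2`. The coefficient of `x^w` in `∂^u f` is
`∏ᵢ (wᵢ+uᵢ)!/wᵢ! = ∏ᵢ descFactorial (wᵢ+uᵢ) uᵢ`; applying the signed binomial sums of this file to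
a vanishing linear combination of these coefficient vectors isolates one coefficient at a time
(neighbour stub `stub_partialsIndependent`).

Mechanism: univariate core `Σ_{j ≤ b} (-1)^{b-j} C(b,j) (j+a)!/j! = a! C(a,b)` from
`(j+a).descFactorial a = a! C(j+a, a)` (`Nat.descFactorial_eq_factorial_mul_choose`), Mathlib's
`fwdDiff_iter_eq_sum_shift` (the `b`-th forward difference as a signed binomial sum) and
`fwdDiff_iter_choose` (`Δ^k C(x, k+j) = C(x, j)`); then the sum over the box `w ≤ v` factorises
coordinatewise (`Finset.prod_univ_sum` through `Finsupp.equivFunOnFinite`) into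
`∏ᵢ uᵢ! C(uᵢ, vᵢ)`, which is `∏ᵢ uᵢ!` if `u = v` and vanishes otherwise, because equal degrees and
`u ≠ v` force some `uᵢ < vᵢ`. Axioms: `propext`, `Classical.choice`, `Quot.sound`.
References: folklore (calculus of finite differences / Newton series); the partial-derivative
measure is Nisan–Wigderson's (1997).
-/

-- layout Summits/ValiantsHypothesis/ValiantsHypothesis forces the duplicated namespace component
set_option linter.dupNamespace false

namespace Summit.ValiantsHypothesis.ValiantsHypothesis.Theorems.BarrierLever.SuccinctHittingSetsForVP

open Literature.Barriers.ValiantsHypothesis Literature.Computability.AlgebraicComplexity MvPolynomial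

namespace RisingDiagonal

/-- The `b`-th forward difference of `x ↦ C(x, a)` evaluated at `a` is `C(a, b)` (for `b ≤ a` it is
`C(a, a - b)`, for `b > a` it vanishes). [folklore] -/
theorem fwdDiff_iter_choose_apply_self (a b : ℕ) :
    (fwdDiff (1 : ℕ))^[b] (fun x : ℕ => (x.choose a : ℤ)) a = (a.choose b : ℤ) := by
  rcases le_or_gt b a with hba | hab
  · obtain ⟨c, rfl⟩ := Nat.exists_eq_add_of_le hba
    rw [fwdDiff_iter_choose c b]
    show (((b + c).choose c : ℕ) : ℤ) = (((b + c).choose b : ℕ) : ℤ)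
    rw [Nat.choose_symm_add]
  · obtain ⟨c, rfl⟩ := Nat.exists_eq_add_of_lt hab
    rw [Nat.choose_eq_zero_of_lt hab, Nat.cast_zero,
      show a + c + 1 = (c + 1) + a by ring, Function.iterate_add_apply]
    have h0 : (fwdDiff (1 : ℕ))^[a] (fun x : ℕ => (x.choose a : ℤ)) = fun x : ℕ => (1 : ℤ) := by
      have h := fwdDiff_iter_choose 0 a
      simp only [add_zero, Nat.choose_zero_right, Nat.cast_one] at h
      exact h
    rw [h0, Function.iterate_succ_apply, fwdDiff_const]
    simp [fwdDiff_iter_eq_sum_shift]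

/-- Univariate core over `ℤ`: `Σ_{j ≤ b} (-1)^{b-j} C(b,j) (j+a)!/j! = a! C(a,b)` — the `b`-th
forward difference at `0` of the degree-`a` polynomial `x ↦ (x+1)(x+2)⋯(x+a) = a! C(x+a, a)`.
[folklore] -/
theorem alternating_sum_descFactorial_int (a b : ℕ) :
    ∑ j ∈ Finset.range (b + 1),
        (-1 : ℤ) ^ (b - j) * (b.choose j : ℤ) * ((j + a).descFactorial a : ℤ) =
      (a.factorial : ℤ) * (a.choose b : ℤ) := by
  have key := fwdDiff_iter_eq_sum_shift (1 : ℕ) (fun x : ℕ => ((x + a).descFactorial a : ℤ)) b 0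
  simp only [zero_add, smul_eq_mul, mul_one] at key
  rw [← key]
  have hf : (fun x : ℕ => ((x + a).descFactorial a : ℤ)) =
      (a.factorial : ℤ) • (fun x : ℕ => ((x + a).choose a : ℤ)) := by
    funext x
    simp only [Pi.smul_apply, smul_eq_mul, Nat.descFactorial_eq_factorial_mul_choose, Nat.cast_mul]
  rw [hf, fwdDiff_iter_const_smul, Pi.smul_apply, smul_eq_mul,
    fwdDiff_iter_comp_add (1 : ℕ) (fun x : ℕ => (x.choose a : ℤ)) a b 0, zero_add,
    fwdDiff_iter_choose_apply_self]

/-- Univariate core over `ℂ`: `Σ_{j ≤ b} (-1)^{b-j} C(b,j) (j+a)!/j! = a! C(a,b)`. [folklore] -/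
theorem alternating_sum_descFactorial (a b : ℕ) :
    ∑ j ∈ Finset.range (b + 1),
        (-1 : ℂ) ^ (b - j) * ((b.choose j : ℕ) : ℂ) * (((j + a).descFactorial a : ℕ) : ℂ) =
      ((a.factorial : ℕ) : ℂ) * ((a.choose b : ℕ) : ℂ) := by
  have h := congrArg (Int.cast : ℤ → ℂ) (alternating_sum_descFactorial_int a b)
  push_cast at h
  exact h

/-- Two exponent vectors with `v ≤ u` pointwise and equal degrees coincide. [folklore] -/
theorem eq_of_forall_le_of_degree_eq {n : ℕ} {u v : Fin n →₀ ℕ} (hle : ∀ i, v i ≤ u i)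
    (hdeg : u.degree = v.degree) : u = v := by
  rw [Finsupp.degree_eq_sum, Finsupp.degree_eq_sum] at hdeg
  have h := (Finset.sum_eq_sum_iff_of_le (fun i _ => hle i)).mp hdeg.symm
  exact Finsupp.ext fun i => (h i (Finset.mem_univ i)).symm

/-- The signed sum over the box `w ≤ v` factorises coordinatewise into the univariate signed sums.
[folklore] -/
theorem sum_Iic_eq_prod {n : ℕ} (u v : Fin n →₀ ℕ) :
    (∑ w ∈ Finset.Iic v, (-1 : ℂ) ^ (v - w).degree *
        (∏ i, (Nat.choose (v i) (w i) : ℂ)) * ∏ i, (Nat.descFactorial (w i + u i) (u i) : ℂ)) =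
      ∏ i, ∑ j ∈ Finset.range (v i + 1),
        (-1 : ℂ) ^ (v i - j) * ((Nat.choose (v i) j : ℕ) : ℂ) *
          (((j + u i).descFactorial (u i) : ℕ) : ℂ) := by
  have hsummand : ∀ w ∈ Finset.Iic v,
      (-1 : ℂ) ^ (v - w).degree * (∏ i, (Nat.choose (v i) (w i) : ℂ)) *
          ∏ i, (Nat.descFactorial (w i + u i) (u i) : ℂ) =
        ∏ i, ((-1 : ℂ) ^ (v i - w i) * ((Nat.choose (v i) (w i) : ℕ) : ℂ) *
          (((w i + u i).descFactorial (u i) : ℕ) : ℂ)) := by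
    intro w _
    rw [Finsupp.degree_eq_sum, ← Finset.prod_pow_eq_pow_sum, Finset.prod_mul_distrib,
      Finset.prod_mul_distrib]
    rfl
  rw [Finset.sum_congr rfl hsummand, Finset.prod_univ_sum]
  refine Finset.sum_equiv Finsupp.equivFunOnFinite (fun w => ?_) (fun w _ => rfl)
  simp only [Finset.mem_Iic, Fintype.mem_piFinset, Finset.mem_range, Nat.lt_succ_iff,
    Finsupp.equivFunOnFinite_apply, Finsupp.le_def]

end RisingDiagonal

/-- **Registered stub `stub_risingDiagonal`** (crux stmt-ValiantsHypothesis-14610, line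
`registered`; rising-factorial finite differences are diagonal on a degree slice): for exponent
vectors `u, v : Fin n →₀ ℕ` of the same degree, the `v`-th iterated forward difference at `0` of
`w ↦ ∏ᵢ (wᵢ + uᵢ)!/wᵢ!`, namely `∑_{w ≤ v} (-1)^{|v-w|} (∏ᵢ C(vᵢ, wᵢ)) ∏ᵢ (wᵢ+uᵢ)!/wᵢ!`, equals
`∏ᵢ uᵢ!` if `u = v` and `0` otherwise. [folklore] -/
theorem stub_risingDiagonal :
    ∀ (n : ℕ) (u v : Fin n →₀ ℕ), u.degree = v.degree →
      (∑ w ∈ Finset.Iic v, (-1 : ℂ) ^ (v - w).degree *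
          (∏ i, (Nat.choose (v i) (w i) : ℂ)) * ∏ i, (Nat.descFactorial (w i + u i) (u i) : ℂ)) =
        if u = v then ∏ i, ((u i).factorial : ℂ) else 0 := by
  intro n u v huv
  rw [RisingDiagonal.sum_Iic_eq_prod]
  simp_rw [RisingDiagonal.alternating_sum_descFactorial]
  rw [Finset.prod_mul_distrib]
  by_cases h : u = v
  · subst h
    rw [if_pos rfl]
    simp only [Nat.choose_self, Nat.cast_one, Finset.prod_const_one, mul_one]
  · rw [if_neg h]
    have hi : ∃ i, u i < v i := by
      by_contra hcon
      exact h (RisingDiagonal.eq_of_forall_le_of_degree_eq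
        (fun i => not_lt.mp (not_exists.mp hcon i)) huv)
    obtain ⟨i, hi⟩ := hi
    rw [Finset.prod_eq_zero (Finset.mem_univ i) (f := fun i => ((Nat.choose (u i) (v i) : ℕ) : ℂ))
      (by rw [Nat.choose_eq_zero_of_lt hi, Nat.cast_zero]), mul_zero]

end Summit.ValiantsHypothesis.ValiantsHypothesis.Theorems.BarrierLever.SuccinctHittingSetsForVP
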